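import Mathlib.Analysis.SpecialFunctions.SmoothTransition
import Mathlib.Analysis.InnerProductSpace.Calculus
import Mathlib.Analysis.Complex.Basic
import Mathlib.Analysis.Real.Pi.Bounds
import Mathlib.Analysis.SpecialFunctions.Complex.Arg
import Mathlib.Analysis.SpecialFunctions.Trigonometric.Inverse
import Literature.Topology.FourManifolds.TorusCoordinates
import Literature.Topology.FourManifolds.UnknotSurgeryModel
import Literature.Topology.FourManifolds.GluckTwistExistence
import HarnessLib

/-!
# The polar model of Iwase's construction: the phase `Pol(x, w)` and the polar map of `S² × ℝ²`

Second infrastructure file (after `UnknotSurgeryModel.lean`, `TorusSurgeryShear.lean`) for the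
model datum of Iwase's theorem "Gluck twists are torus surgeries"
(`TorusSurgeryIwaseReduction.lean`, `Literature.Topology.FourManifolds.iwase1988_of_model`;
Z. Iwase, *Dehn-surgery along a torus T²-knot*, Pacific J. Math. 133 (1988), Prop. 3.5, proof
p. 297: "Finally, extend `F|∂(D₀ × D)` … to `D₀ × D`" — the step over the two polar 4-balls, which
the paper leaves to the reader). In the model `M = S² × ℝ²` with the inverse Gluck map
`G⁻¹ (p, w) = (rot_{w̄/‖w‖} p, w)` (`gluckMapInv`), the model torus meets the polar region
`{‖w‖ < 1}` in the surface of revolution `w = g(‖y‖²)` over the sphere, where `y = x₀ + i x₁` is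
the equatorial coordinate (`ycoord`, `xsq = ‖y‖²`) and `g` is the **profile** (`gprof`:
`g(x) = 1 - x` on the column `x ≤ 1/10`, `g = 0` on the sphere part `x ≥ 1/5`, a smooth monotone
corner in between) — the 2-knot `S² × 0` with its two polar caps pushed up the normal direction
into the columns around the polar axes (Iwase's annuli `A₀`, `A_∞`; here for both poles at once,
since everything only depends on `‖y‖²`). This file constructs the diffeomorphism of the
complement of this surface that replaces `G⁻¹` on the polar region:

* `Literature.Topology.FourManifolds.IwasePolar.pol x w` — **the polar phase**, a unit complex
  number depending on `x = ‖y‖² ≥ 0` and `w`, `‖w‖ < 1`, smooth off the profile `w = g(x)`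
  (`contDiffAt_pol`, `norm_pol`): below the height `9/10` it is `(w - g(x))‾/‖w - g(x)‖`
  (`lowPol`; smooth across the caps `w = 0 < g(x)`, equal to the Gluck phase `w̄/‖w‖` where
  `g = 0`); above, `w̄/‖w‖ · B̄/‖B‖` (`highPol`) with the blend `B = (1 - μ) A/‖A‖ + μ`
  (`bfun`) of the unit vector of `A = 1 - g(x)/w` (`afun`) and `1`, weighted by the slice
  cut-off `μ = μ₁(‖w‖²) · smoothTransition (x/(1 - ‖w‖) + (arg w)² - 4)` (`muP`, `mu1`, `inner`)
  — exactly the data of the handle slice model `UnknotSurgery.theta` (profile `G(u) = g(x₀ u)/r`,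
  radial cut-off) transported by the equivariant handle chart at height `r = ‖w‖`, column
  position `x₀(r) = 1 - r`, switched on between the heights `9/10` and `49/50`. The blend never
  vanishes off the torus (`bfun_ne_zero`: the half-plane sign argument — `Im A = g Im w/‖w‖²`
  has the sign of `Im w`, so `B = 0` forces `w ∈ (0, g(x))` real, where `μ = 0`); near the
  negative real axis the cut-off is complete (`lt_abs_arg_of_cone`: `|arg w| > 3π/4` on a cone),
  whence the smoothness of `μ` across the discontinuity of `arg`.
* `pol_eq_of_gprof_eq_zero`, `pol_eq_of_muP_eq_one`: the phase is the Gluck phase off the polar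
  caps and where the cut-off is complete; `pol_eq_of_muP_eq_zero`: **exactness** — at
  `w = g(x) + v` with the cut-off absent the phase is `v̄/‖v‖`, the inverse unit vector of the
  vertical displacement, which is what makes the vertical tubular parametrisation of the torus
  adapted (the polar map composed with the shear is the tube map itself).
* `Literature.Topology.FourManifolds.IwasePolar.polarMap (p, w) = (rot_{Pol} p, w)` and
  `polarMapInv` on `S² × ℝ²` (`circleOf`: unit complex number ↦ point of `𝕊¹ ⊆ ℝ²`,
  `rotateSphereTwo`): mutually inverse off the torus (`polarMap_polarMapInv`,
  `polarMapInv_polarMap`; the phase is rotation invariant), equal to `gluckMapInv` off the caps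
  and where the cut-off is complete (`polarMap_eq_gluckMapInv_of_gprof`, `…_of_muP`), and smooth
  off the torus (`contMDiffAt_polarMap`).

The handle of the torus (the 1-handle through the exterior, attached to the tops of the two
columns), the global assembly of `Φ`, the framed tori `T₀, T₁` and the verification of the fibre
relation are left to the sibling files of the programme (design in the seat's notes).

## References

* Z. Iwase, *Dehn-surgery along a torus T²-knot*, Pacific J. Math. 133 (1988) 289–299, proof of
  Prop. 3.5, p. 297. [Iwase1988]
* H. Gluck, *The embedding of two-spheres in the four-sphere*, Trans. AMS 104 (1962), §8
  [GluckTAMS1962].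

## Design notes

* All constants are fixed rationals (`1/10`, `1/5`, `9/10`, `49/50`, `17/20`); `g₀ = g₁ = 1`.
* `pol` is defined by cases on `‖w‖ < 9/10`; the two formulas agree where the slice cut-off
  vanishes (`highPol_eq_lowPol`), including in their junk values on the torus itself.
* Junk values: `pol = 0` on the torus `w = g(x)`; `circleOf 0 = (1, 0)`; never used.
* No declaration in this file uses `sorry`.
-/

open scoped ContDiff Manifold Topology
open Complex Set Function

noncomputable section

namespace Literature.Topology.FourManifolds

namespace IwasePolar

open UnknotSurgery

/-! ### The profile `g` of the polar arc and the height cut-off `μ₁` -/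

/-- **The profile of the polar arc**, as a function of `x = ‖y‖² = 1 - x₂²`:
`g(x) = (1 - x) · (1 - smoothTransition (10 x - 1))`, i.e. `g(x) = 1 - x` for `x ≤ 1/10` (the
affine column), `g = 0` for `x ≥ 1/5` (the sphere part `w = 0`), smooth, `0 ≤ g ≤ 1 - x` and
`g > 0` for `x < 1/5` (the corner). The model torus meets the polar region in the surface of
revolution `w = g(‖y‖²)`. [folklore] -/
def gprof (x : ℝ) : ℝ := (1 - x) * (1 - Real.smoothTransition (10 * x - 1))

/-- The profile is smooth. [folklore] -/
theorem contDiff_gprof : ContDiff ℝ ∞ gprof :=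
  (contDiff_const.sub contDiff_id).mul (contDiff_const.sub
    (Real.smoothTransition.contDiff.comp ((contDiff_const.mul contDiff_id).sub contDiff_const)))

/-- On the column `x ≤ 1/10` the profile is affine: `g(x) = 1 - x`. [folklore] -/
theorem gprof_of_le {x : ℝ} (hx : x ≤ 1 / 10) : gprof x = 1 - x := by
  rw [gprof, Real.smoothTransition.zero_of_nonpos (by linarith)]
  ring

/-- On the sphere part `x ≥ 1/5` the profile vanishes. [folklore] -/
theorem gprof_of_ge {x : ℝ} (hx : 1 / 5 ≤ x) : gprof x = 0 := by
  rw [gprof, Real.smoothTransition.one_of_one_le (by linarith)]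
  ring

/-- The profile is non-negative. [folklore] -/
theorem gprof_nonneg (x : ℝ) : 0 ≤ gprof x := by
  by_cases hx : x ≤ 1
  · exact mul_nonneg (by linarith) (by linarith [Real.smoothTransition.le_one (10 * x - 1)])
  · rw [gprof_of_ge (by linarith)]

/-- The profile is at most the affine column profile: `g(x) ≤ 1 - x` for `x ≤ 1`. [folklore] -/
theorem gprof_le {x : ℝ} (hx : x ≤ 1) : gprof x ≤ 1 - x := by
  unfold gprof
  have h0 := Real.smoothTransition.nonneg (10 * x - 1)
  nlinarith

/-- The profile is positive on the corner and the column, `x < 1/5`. [folklore] -/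
theorem gprof_pos {x : ℝ} (hx : x < 1 / 5) : 0 < gprof x := by
  have := Real.smoothTransition.lt_one_of_lt_one (x := 10 * x - 1) (by linarith)
  exact mul_pos (by linarith) (by linarith)

/-- The profile is at most `1`. [folklore] -/
theorem gprof_le_one (x : ℝ) (hx : 0 ≤ x) : gprof x ≤ 1 := by
  by_cases h1 : x ≤ 1
  · linarith [gprof_le h1]
  · rw [gprof_of_ge (by linarith)]; exact zero_le_one

/-- A positive value `c` of the profile is only taken at `x ≤ 1 - c` (`g ≤ 1 - x`): in particular
`9/10 ≤ g(x)` forces `x ≤ 1/10`, the affine column. [folklore] -/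
theorem le_of_le_gprof {x c : ℝ} (hc : 0 < c) (h : c ≤ gprof x) : x ≤ 1 - c := by
  by_cases h1 : x ≤ 1
  · linarith [gprof_le h1]
  · rw [gprof_of_ge (by linarith)] at h
    linarith

/-- **The height cut-off** `μ₁(t) = smoothTransition ((t - 0.81)/(0.9604 - 0.81))` as a function
of `t = ‖w‖²`: `0` for `‖w‖ ≤ 9/10`, `1` for `‖w‖ ≥ 49/50`. [folklore] -/
def mu1 (t : ℝ) : ℝ := Real.smoothTransition ((t - (9 / 10) ^ 2) / ((49 / 50) ^ 2 - (9 / 10) ^ 2))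

/-- `μ₁` is smooth. [folklore] -/
theorem contDiff_mu1 : ContDiff ℝ ∞ mu1 :=
  Real.smoothTransition.contDiff.comp ((contDiff_id.sub contDiff_const).div_const _)

/-- `μ₁ = 0` below the height `9/10`. [folklore] -/
theorem mu1_eq_zero {t : ℝ} (ht : t ≤ (9 / 10) ^ 2) : mu1 t = 0 :=
  Real.smoothTransition.zero_of_nonpos (div_nonpos_of_nonpos_of_nonneg (by linarith) (by norm_num))

/-- `μ₁ = 1` above the height `49/50`. [folklore] -/
theorem mu1_eq_one {t : ℝ} (ht : (49 / 50 : ℝ) ^ 2 ≤ t) : mu1 t = 1 :=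
  Real.smoothTransition.one_of_one_le ((one_le_div (by norm_num)).2 (by linarith))

/-- `0 ≤ μ₁ ≤ 1`. [folklore] -/
theorem mu1_mem (t : ℝ) : 0 ≤ mu1 t ∧ mu1 t ≤ 1 :=
  ⟨Real.smoothTransition.nonneg _, Real.smoothTransition.le_one _⟩

/-! ### The functions `A = 1 - g(x)/w`, the slice cut-off `μ` and the blend `B` -/

/-- `A(x, w) = 1 - g(x)/w` (`w ≠ 0`): vanishes exactly on the polar arc `w = g(x) > 0`, and
`Im A = g(x) Im w / ‖w‖²` has the sign of `Im w`. [folklore] -/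
def afun (x : ℝ) (w : ℂ) : ℂ := 1 - (gprof x : ℂ) / w

/-- `w · A = w - g(x)` for `w ≠ 0`. [folklore] -/
theorem mul_afun {x : ℝ} {w : ℂ} (hw : w ≠ 0) : w * afun x w = w - gprof x := by
  rw [afun, mul_sub, mul_one, mul_div_cancel₀ _ hw]

/-- `A = 0` iff `w = g(x)` (`w ≠ 0`). [folklore] -/
theorem afun_eq_zero_iff {x : ℝ} {w : ℂ} (hw : w ≠ 0) : afun x w = 0 ↔ w = gprof x := by
  rw [← mul_right_inj' hw, mul_afun hw, mul_zero, sub_eq_zero]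

/-- Imaginary part of `A`. [folklore] -/
theorem afun_im (x : ℝ) (w : ℂ) : (afun x w).im = gprof x * w.im / Complex.normSq w := by
  rw [afun, Complex.sub_im, Complex.one_im, Complex.div_im, Complex.ofReal_re, Complex.ofReal_im]
  ring

/-- Real part of `A`. [folklore] -/
theorem afun_re (x : ℝ) (w : ℂ) : (afun x w).re = 1 - gprof x * w.re / Complex.normSq w := by
  rw [afun, Complex.sub_re, Complex.one_re, Complex.div_re, Complex.ofReal_re, Complex.ofReal_im]
  ring

/-- If the profile vanishes, `A = 1`. [folklore] -/
theorem afun_eq_one {x : ℝ} (hx : gprof x = 0) (w : ℂ) : afun x w = 1 := by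
  simp [afun, hx]

/-- `A` is jointly smooth in `(x, w)` for `w ≠ 0`. [folklore] -/
theorem contDiffAt_afun {x : ℝ} {w : ℂ} (hw : w ≠ 0) :
    ContDiffAt ℝ ∞ (fun q : ℝ × ℂ => afun q.1 q.2) (x, w) := by
  unfold afun
  have h1 : ContDiffAt ℝ ∞ (fun q : ℝ × ℂ => (gprof q.1 : ℂ)) (x, w) :=
    Complex.ofRealCLM.contDiff.contDiffAt.comp (x, w) (contDiff_gprof.contDiffAt.comp (x, w)
      contDiffAt_fst)
  have h2 : ContDiffAt ℝ ∞ (fun q : ℝ × ℂ => (gprof q.1 : ℂ) * q.2⁻¹) (x, w) :=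
    h1.mul (contDiffAt_snd.inv hw)
  simpa [div_eq_mul_inv] using contDiffAt_const.sub h2

/-- The argument of the slice cut-off: `x / x₀(‖w‖) + (arg w)² - 4` with `x₀(r) = 1 - r` the
position of the column at height `r` (model units of the handle slice: `‖ζ‖² + c² - 4`).
[folklore] -/
def inner (x : ℝ) (w : ℂ) : ℝ := x / (1 - ‖w‖) + (arg w) ^ 2 - 4

/-- **The slice cut-off** `μ(x, w) = μ₁(‖w‖²) · smoothTransition (x/(1 - ‖w‖) + (arg w)² - 4)`:
absent below the height `9/10`, and above `49/50` equal to the radial cut-off of the handle slice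
model transported by the equivariant handle chart. [folklore] -/
def muP (x : ℝ) (w : ℂ) : ℝ := mu1 (‖w‖ ^ 2) * Real.smoothTransition (inner x w)

/-- `0 ≤ μ ≤ 1`. [folklore] -/
theorem muP_mem (x : ℝ) (w : ℂ) : 0 ≤ muP x w ∧ muP x w ≤ 1 := by
  obtain ⟨h0, h1⟩ := mu1_mem (‖w‖ ^ 2)
  have h2 := Real.smoothTransition.nonneg (inner x w)
  have h3 := Real.smoothTransition.le_one (inner x w)
  exact ⟨mul_nonneg h0 h2, (mul_le_mul h1 h3 h2 zero_le_one).trans (by norm_num)⟩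

/-- The slice cut-off is absent below the height `9/10`. [folklore] -/
theorem muP_eq_zero_of_norm_le {x : ℝ} {w : ℂ} (hw : ‖w‖ ≤ 9 / 10) : muP x w = 0 := by
  rw [muP, mu1_eq_zero (pow_le_pow_left₀ (norm_nonneg _) hw 2), zero_mul]

/-- The slice cut-off vanishes where its argument is non-positive. [folklore] -/
theorem muP_eq_zero_of_inner_le {x : ℝ} {w : ℂ} (h : inner x w ≤ 0) : muP x w = 0 := by
  rw [muP, Real.smoothTransition.zero_of_nonpos h, mul_zero]

/-- The slice cut-off is the height cut-off where its argument is at least `1`. [folklore] -/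
theorem muP_eq_mu1_of_le_inner {x : ℝ} {w : ℂ} (h : 1 ≤ inner x w) : muP x w = mu1 (‖w‖ ^ 2) := by
  rw [muP, Real.smoothTransition.one_of_one_le h, mul_one]

/-- **The cut-off vanishes on the open spanning segment**: for `w` real with `0 < w < g(x)`,
`x ≥ 0`, one has `x < x₀(w)`, so the argument of the slice cut-off is negative. [folklore] -/
theorem muP_eq_zero_of_real {x : ℝ} {w : ℂ} (hw1 : ‖w‖ < 1) (him : w.im = 0)
    (hre : 0 < w.re) (hlt : w.re < gprof x) : muP x w = 0 := by
  apply muP_eq_zero_of_inner_le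
  have hx1 : x ≤ 1 := by
    by_contra hcon
    push Not at hcon
    linarith [gprof_of_ge (show (1 : ℝ) / 5 ≤ x by linarith), gprof_nonneg x]
  have hnorm : ‖w‖ = w.re := by
    have : w = (w.re : ℂ) := Complex.ext (by simp) (by simp [him])
    rw [this, Complex.norm_real, Real.norm_eq_abs, abs_of_pos hre, Complex.ofReal_re]
  have harg : arg w = 0 := arg_eq_zero_iff.2 ⟨hre.le, him⟩
  have hg := gprof_le hx1
  rw [inner, harg, hnorm]
  have h1 : 0 < 1 - w.re := by linarith
  have h2 : x / (1 - w.re) ≤ 1 := (div_le_one h1).2 (by linarith)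
  nlinarith

/-- **The blend** `B = (1 - μ) · A/‖A‖ + μ · 1`. [folklore] -/
def bfun (x : ℝ) (w : ℂ) : ℂ := Complex.ofReal (1 - muP x w) * nrm (afun x w) + Complex.ofReal (muP x w)

/-- **The blend never vanishes off the torus** (`0 < ‖w‖ < 1`, `w ≠ g(x)`): the
half-plane sign argument — `B = 0` forces `Im A = 0`, i.e. `w` real, then `Re A ≤ 0`, i.e.
`0 < w < g(x)`, where the cut-off vanishes and `B = A/‖A‖ ≠ 0`. [folklore] -/
theorem bfun_ne_zero {x : ℝ} {w : ℂ} (hw0 : w ≠ 0) (hw1 : ‖w‖ < 1) (hwg : w ≠ gprof x) :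
    bfun x w ≠ 0 := by
  intro h0
  obtain ⟨hμ0, hμ1⟩ := muP_mem x w
  have hA : afun x w ≠ 0 := fun h => hwg ((afun_eq_zero_iff hw0).1 h)
  rcases hμ1.lt_or_eq with hlt | heq
  · have h1 : 0 < 1 - muP x w := by linarith
    have hninv : 0 < ‖afun x w‖⁻¹ := inv_pos.2 (norm_pos_iff.2 hA)
    have him : (1 - muP x w) * (‖afun x w‖⁻¹ * (afun x w).im) = 0 := by
      have := congrArg Complex.im h0
      simpa [bfun, Complex.re_ofReal_mul, Complex.im_ofReal_mul, nrm_im] using this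
    have hre : (1 - muP x w) * (‖afun x w‖⁻¹ * (afun x w).re) + muP x w = 0 := by
      have := congrArg Complex.re h0
      simpa [bfun, Complex.re_ofReal_mul, Complex.im_ofReal_mul, nrm_re] using this
    have him' : (afun x w).im = 0 := by
      rcases mul_eq_zero.1 him with h | h
      · linarith
      · rcases mul_eq_zero.1 h with h' | h'
        · linarith
        · exact h'
    have hre' : (afun x w).re ≤ 0 := by
      by_contra hcon
      push Not at hcon
      nlinarith [mul_pos hninv hcon]
    -- `Im A = 0`: either `g(x) = 0` (then `A = 1`, absurd) or `w` is real
    have hnsq : 0 < Complex.normSq w := Complex.normSq_pos.2 hw0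
    rw [afun_im, div_eq_zero_iff, or_iff_left hnsq.ne'] at him'
    rcases mul_eq_zero.1 him' with hg0 | hwim
    · rw [afun_re, hg0] at hre'
      norm_num at hre'
    · -- `Re A ≤ 0`: `w` is a positive real `≤ g(x)`
      rw [afun_re, sub_nonpos, le_div_iff₀ hnsq, one_mul, Complex.normSq_apply, hwim, mul_zero,
        add_zero] at hre'
      have hwre_ne : w.re ≠ 0 := fun h => hw0 (Complex.ext (by simp [h]) (by simp [hwim]))
      have hsq : 0 < w.re * w.re := mul_self_pos.2 hwre_ne
      have hg0 := gprof_nonneg x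
      have hwre : 0 < w.re := by
        by_contra hcon
        push Not at hcon
        nlinarith
      have hle : w.re ≤ gprof x := le_of_mul_le_mul_right (by linarith) hwre
      have hlt' : w.re < gprof x := lt_of_le_of_ne hle fun h => hwg (Complex.ext (by simp [h])
        (by simp [hwim]))
      have hμ := muP_eq_zero_of_real hw1 hwim hwre hlt'
      rw [bfun, hμ] at h0
      simp only [sub_zero, Complex.ofReal_one, one_mul, Complex.ofReal_zero, add_zero] at h0
      exact nrm_ne_zero hA h0
  · rw [bfun, heq] at h0
    norm_num at h0

/-! ### Smoothness of the slice cut-off (the negative axis is inside the complete zone) -/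

/-- On the cone `{Re w < 0, |Im w| < -Re w}` around the negative real axis, `|arg w| > 3π/4`.
[folklore] -/
theorem lt_abs_arg_of_cone {w : ℂ} (hre : w.re < 0) (him : |w.im| < -w.re) :
    3 * Real.pi / 4 < |arg w| := by
  have hw0 : w ≠ 0 := fun h => by rw [h] at hre; simp at hre
  have hnorm : 0 < ‖w‖ := norm_pos_iff.2 hw0
  have hcos : Real.cos (arg w) = w.re / ‖w‖ := Complex.cos_arg hw0
  -- `w.re / ‖w‖ < -√2/2`
  have hsq : ‖w‖ ^ 2 = w.re ^ 2 + w.im ^ 2 := by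
    rw [Complex.sq_norm, Complex.normSq_apply]; ring
  have him2 : w.im ^ 2 < w.re ^ 2 := by
    have := sq_lt_sq' (by linarith [abs_nonneg w.im, neg_abs_le w.im]) him
    simpa [sq_abs] using (sq_lt_sq.2 (by rwa [abs_of_neg hre] : |w.im| < |w.re|))
  have hlt : w.re / ‖w‖ < -(Real.sqrt 2 / 2) := by
    rw [div_lt_iff₀ hnorm]
    have h2 : Real.sqrt 2 ^ 2 = 2 := Real.sq_sqrt (by norm_num)
    have hs : 0 < Real.sqrt 2 := Real.sqrt_pos.2 (by norm_num)
    nlinarith [sq_nonneg (‖w‖ * Real.sqrt 2 / 2 + w.re), hsq]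
  have hcos34 : Real.cos (3 * Real.pi / 4) = -(Real.sqrt 2 / 2) := by
    rw [show 3 * Real.pi / 4 = Real.pi - Real.pi / 4 by ring, Real.cos_pi_sub, Real.cos_pi_div_four]
  by_contra hcon
  push Not at hcon
  have h := Real.cos_le_cos_of_nonneg_of_le_pi (abs_nonneg (arg w)) (by linarith [Real.pi_pos]) hcon
  rw [hcos34, Real.cos_abs, hcos] at h
  linarith

/-- On the cone around the negative axis (`x/(1 - ‖w‖) > -1/2`) the argument of the slice
cut-off exceeds `1`, so the slice cut-off is the height cut-off there. [folklore] -/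
theorem one_lt_inner_of_cone {x : ℝ} {w : ℂ} (hre : w.re < 0) (him : |w.im| < -w.re) (hw1 : ‖w‖ < 1)
    (hx : -(1 - ‖w‖) / 2 < x) : 1 < inner x w := by
  have ha := lt_abs_arg_of_cone hre him
  have hπ : (3.14 : ℝ) < Real.pi := Real.pi_gt_d2
  have h1 : (2.355 : ℝ) < |arg w| := by linarith
  have h2 : (2.355 : ℝ) ^ 2 < (arg w) ^ 2 := by
    rw [← sq_abs (arg w)]; exact pow_lt_pow_left₀ h1 (by norm_num) two_ne_zero
  have h3 : -(1 / 2 : ℝ) < x / (1 - ‖w‖) := by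
    rw [lt_div_iff₀ (by linarith)]; linarith
  unfold inner
  nlinarith

/-- **The slice cut-off is jointly smooth** in `(x, w)` on `{w ≠ 0, ‖w‖ < 1, x > -(1 - ‖w‖)/2}`:
off the negative real axis `arg` is smooth; on the cone around it the cut-off is the height
cut-off `μ₁(‖w‖²)`. [folklore] -/
theorem contDiffAt_muP {x : ℝ} {w : ℂ} (hw0 : w ≠ 0) (hw1 : ‖w‖ < 1) (hx : -(1 - ‖w‖) / 2 < x) :
    ContDiffAt ℝ ∞ (fun q : ℝ × ℂ => muP q.1 q.2) (x, w) := by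
  have hmu1 : ContDiffAt ℝ ∞ (fun q : ℝ × ℂ => mu1 (‖q.2‖ ^ 2)) (x, w) :=
    contDiff_mu1.contDiffAt.comp (x, w) (((contDiffAt_norm ℝ hw0).comp (x, w) contDiffAt_snd).pow 2)
  by_cases hs : w ∈ slitPlane
  · have hnorm : ContDiffAt ℝ ∞ (fun q : ℝ × ℂ => ‖q.2‖) (x, w) :=
      (contDiffAt_norm ℝ hw0).comp (x, w) contDiffAt_snd
    have hden : ContDiffAt ℝ ∞ (fun q : ℝ × ℂ => 1 - ‖q.2‖) (x, w) := contDiffAt_const.sub hnorm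
    have harg : ContDiffAt ℝ ∞ (arg ∘ fun q : ℝ × ℂ => q.2) (x, w) :=
      (contDiffAt_arg hs).comp (x, w) contDiffAt_snd
    have hinner : ContDiffAt ℝ ∞ (fun q : ℝ × ℂ => inner q.1 q.2) (x, w) := by
      unfold inner
      exact ((contDiffAt_fst.div hden (by show (1 : ℝ) - ‖w‖ ≠ 0; linarith)).add
        (harg.pow 2)).sub contDiffAt_const
    unfold muP
    exact hmu1.mul (Real.smoothTransition.contDiffAt.comp (x, w) hinner)
  · -- `w` is on the negative real axis: use the cone
    rw [mem_slitPlane_iff, not_or, not_lt] at hs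
    obtain ⟨hre, him⟩ := hs
    push Not at him
    have hre' : w.re < 0 := lt_of_le_of_ne hre fun h => hw0 (Complex.ext h him)
    have hopen : IsOpen {q : ℝ × ℂ | q.2.re < 0 ∧ |q.2.im| < -q.2.re ∧ ‖q.2‖ < 1 ∧
        -(1 - ‖q.2‖) / 2 < q.1} := by
      refine (isOpen_lt (Complex.continuous_re.comp continuous_snd) continuous_const).and
        ((isOpen_lt (continuous_abs.comp (Complex.continuous_im.comp continuous_snd))
        ((Complex.continuous_re.comp continuous_snd).neg)).and ((isOpen_lt
        (continuous_norm.comp continuous_snd) continuous_const).and (isOpen_lt ?_ continuous_fst)))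
      exact ((continuous_const.sub (continuous_norm.comp continuous_snd)).neg).div_const _
    have hmem : (x, w) ∈ {q : ℝ × ℂ | q.2.re < 0 ∧ |q.2.im| < -q.2.re ∧ ‖q.2‖ < 1 ∧
        -(1 - ‖q.2‖) / 2 < q.1} := ⟨hre', by rw [him, abs_zero]; linarith, hw1, hx⟩
    have hev : ∀ᶠ q : ℝ × ℂ in nhds (x, w), muP q.1 q.2 = mu1 (‖q.2‖ ^ 2) := by
      filter_upwards [hopen.mem_nhds hmem] with q hq
      exact muP_eq_mu1_of_le_inner (one_lt_inner_of_cone hq.1 hq.2.1 hq.2.2.1 hq.2.2.2).le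
    exact hmu1.congr_of_eventuallyEq hev

/-- **The blend is jointly smooth** in `(x, w)` off the torus on `{w ≠ 0, ‖w‖ < 1,
x > -(1 - ‖w‖)/2}`. [folklore] -/
theorem contDiffAt_bfun {x : ℝ} {w : ℂ} (hw0 : w ≠ 0) (hw1 : ‖w‖ < 1) (hx : -(1 - ‖w‖) / 2 < x)
    (hwg : w ≠ gprof x) : ContDiffAt ℝ ∞ (fun q : ℝ × ℂ => bfun q.1 q.2) (x, w) := by
  have hA : afun x w ≠ 0 := fun h => hwg ((afun_eq_zero_iff hw0).1 h)
  have hμ := contDiffAt_muP hw0 hw1 hx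
  unfold bfun
  exact ((Complex.ofRealCLM.contDiff.contDiffAt.comp (x, w) (contDiffAt_const.sub hμ)).mul
    ((contDiffAt_nrm hA).comp (x, w) (contDiffAt_afun hw0))).add
    (Complex.ofRealCLM.contDiff.contDiffAt.comp (x, w) hμ)

/-! ### The polar phase -/

/-- The low formula of the phase, `(w - g(x))‾/‖w - g(x)‖`, used below the height `9/10`; smooth
across the cap `w = 0` where `g(x) > 0`. [folklore] -/
def lowPol (x : ℝ) (w : ℂ) : ℂ := (nrm (w - gprof x))⁻¹

/-- The high formula of the phase, `w‾/‖w‖ · B‾/‖B‖`, used above the height `9/10`. [folklore] -/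
def highPol (x : ℝ) (w : ℂ) : ℂ := (nrm w)⁻¹ * (nrm (bfun x w))⁻¹

/-- **The polar phase** `Pol(x, w)`: the unit complex number by which the polar map rotates the
sphere point with `‖y‖² = x` over the normal coordinate `w` — the low formula below the height
`9/10`, the high formula above. [folklore] -/
def pol (x : ℝ) (w : ℂ) : ℂ := if ‖w‖ < 9 / 10 then lowPol x w else highPol x w

/-- Where the slice cut-off vanishes the two formulas agree (`w ≠ 0`): `B = A/‖A‖` and
`w · A = w - g(x)`. [folklore] -/
theorem highPol_eq_lowPol {x : ℝ} {w : ℂ} (hw0 : w ≠ 0) (hμ : muP x w = 0) :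
    highPol x w = lowPol x w := by
  by_cases hA : afun x w = 0
  · have hwg : w - gprof x = 0 := sub_eq_zero.2 ((afun_eq_zero_iff hw0).1 hA)
    rw [highPol, lowPol, bfun, hμ, hA, hwg]
    simp [nrm]
  · rw [highPol, lowPol, bfun, hμ]
    simp only [sub_zero, Complex.ofReal_one, one_mul, Complex.ofReal_zero, add_zero]
    rw [nrm_nrm hA, ← mul_inv, ← nrm_mul, mul_afun hw0]

/-- Below the height `9/10` the high formula agrees with the low one (`w ≠ 0`). [folklore] -/
theorem highPol_eq_lowPol_of_norm_le {x : ℝ} {w : ℂ} (hw0 : w ≠ 0) (hw : ‖w‖ ≤ 9 / 10) :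
    highPol x w = lowPol x w :=
  highPol_eq_lowPol hw0 (muP_eq_zero_of_norm_le hw)

/-- The phase is the high formula at every height `≥ 17/20` (`w ≠ 0` there). [folklore] -/
theorem pol_eq_highPol {x : ℝ} {w : ℂ} (hw : 17 / 20 ≤ ‖w‖) : pol x w = highPol x w := by
  unfold pol
  split_ifs with h
  · exact (highPol_eq_lowPol_of_norm_le (fun h0 => by rw [h0, norm_zero] at hw; linarith)
      h.le).symm
  · rfl

/-- The phase is the low formula below the height `9/10`. [folklore] -/
theorem pol_eq_lowPol {x : ℝ} {w : ℂ} (hw : ‖w‖ < 9 / 10) : pol x w = lowPol x w := if_pos hw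

/-- **The phase is a unit off the torus** (`‖w‖ < 1`, `w ≠ g(x)`). [folklore] -/
theorem norm_pol {x : ℝ} {w : ℂ} (hw1 : ‖w‖ < 1) (hwg : w ≠ gprof x) : ‖pol x w‖ = 1 := by
  unfold pol
  split_ifs with h
  · rw [lowPol, norm_inv, norm_nrm (sub_ne_zero.2 hwg), inv_one]
  · have hw0 : w ≠ 0 := fun h0 => by rw [h0, norm_zero] at h; norm_num at h
    rw [highPol, norm_mul, norm_inv, norm_inv, norm_nrm hw0, norm_nrm (bfun_ne_zero hw0 hw1 hwg),
      inv_one, one_mul]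

/-- The phase is non-zero off the torus. [folklore] -/
theorem pol_ne_zero {x : ℝ} {w : ℂ} (hw1 : ‖w‖ < 1) (hwg : w ≠ gprof x) : pol x w ≠ 0 :=
  norm_ne_zero_iff.1 (by rw [norm_pol hw1 hwg]; exact one_ne_zero)

/-- **Where the profile vanishes the phase is the Gluck phase** `w‾/‖w‖` (the polar map is the
inverse Gluck map there: the sphere part of the torus, the lateral part of the polar region).
[folklore] -/
theorem pol_eq_of_gprof_eq_zero {x : ℝ} (hx : gprof x = 0) (w : ℂ) : pol x w = (nrm w)⁻¹ := by
  unfold pol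
  split_ifs with h
  · rw [lowPol, hx, Complex.ofReal_zero, sub_zero]
  · rw [highPol, bfun, afun_eq_one hx]
    simp [nrm_of_norm_eq_one (u := 1) (by simp)]

/-- **Exactness**: at the point `w = g(x) + v` over the arc with the slice cut-off absent, the
phase is the inverse unit vector `v‾/‖v‖` of the vertical displacement. [folklore] -/
theorem pol_eq_of_muP_eq_zero {x : ℝ} {w : ℂ} (hw0 : w ≠ 0) (hμ : muP x w = 0) :
    pol x w = (nrm (w - gprof x))⁻¹ := by
  unfold pol
  split_ifs with h
  · rfl
  · exact highPol_eq_lowPol hw0 hμ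

/-- Where the slice cut-off is complete (heights `≥ 17/20`) the phase is the Gluck phase
`w‾/‖w‖`. [folklore] -/
theorem pol_eq_of_muP_eq_one {x : ℝ} {w : ℂ} (hw : 17 / 20 ≤ ‖w‖) (hμ : muP x w = 1) :
    pol x w = (nrm w)⁻¹ := by
  rw [pol_eq_highPol hw, highPol, bfun, hμ]
  simp [nrm_of_norm_eq_one (u := 1) (by simp)]

/-- **The phase is jointly smooth off the torus** on `{‖w‖ < 1, x > -(1 - ‖w‖)/2, w ≠ g(x)}`.
[folklore] -/
theorem contDiffAt_pol {x : ℝ} {w : ℂ} (hw1 : ‖w‖ < 1) (hx : -(1 - ‖w‖) / 2 < x)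
    (hwg : w ≠ gprof x) : ContDiffAt ℝ ∞ (fun q : ℝ × ℂ => pol q.1 q.2) (x, w) := by
  have hsub : ContDiffAt ℝ ∞ (fun q : ℝ × ℂ => q.2 - gprof q.1) (x, w) :=
    contDiffAt_snd.sub (Complex.ofRealCLM.contDiff.contDiffAt.comp (x, w)
      (contDiff_gprof.contDiffAt.comp (x, w) contDiffAt_fst))
  have hlow : ContDiffAt ℝ ∞ (fun q : ℝ × ℂ => lowPol q.1 q.2) (x, w) := by
    have h1 : ContDiffAt ℝ ∞ (nrm ∘ fun q : ℝ × ℂ => q.2 - gprof q.1) (x, w) :=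
      (contDiffAt_nrm (sub_ne_zero.2 hwg)).comp (x, w) hsub
    exact h1.inv (nrm_ne_zero (sub_ne_zero.2 hwg))
  by_cases h : ‖w‖ < 9 / 10
  · have hev : ∀ᶠ q : ℝ × ℂ in nhds (x, w), pol q.1 q.2 = lowPol q.1 q.2 := by
      filter_upwards [(isOpen_lt (continuous_norm.comp continuous_snd) continuous_const).mem_nhds
        (show (x, w) ∈ {q : ℝ × ℂ | ‖q.2‖ < 9 / 10} from h)] with q hq
      exact pol_eq_lowPol hq
    exact hlow.congr_of_eventuallyEq hev
  · push Not at h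
    have hw0 : w ≠ 0 := fun h0 => by rw [h0, norm_zero] at h; norm_num at h
    have hhigh : ContDiffAt ℝ ∞ (fun q : ℝ × ℂ => highPol q.1 q.2) (x, w) := by
      have h2 : ContDiffAt ℝ ∞ (nrm ∘ fun q : ℝ × ℂ => q.2) (x, w) :=
        (contDiffAt_nrm hw0).comp (x, w) contDiffAt_snd
      have h3 : ContDiffAt ℝ ∞ (nrm ∘ fun q : ℝ × ℂ => bfun q.1 q.2) (x, w) :=
        (contDiffAt_nrm (bfun_ne_zero hw0 hw1 hwg)).comp (x, w) (contDiffAt_bfun hw0 hw1 hx hwg)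
      exact (h2.inv (nrm_ne_zero hw0)).mul (h3.inv (nrm_ne_zero (bfun_ne_zero hw0 hw1 hwg)))
    have hev : ∀ᶠ q : ℝ × ℂ in nhds (x, w), pol q.1 q.2 = highPol q.1 q.2 := by
      filter_upwards [(isOpen_lt continuous_const (continuous_norm.comp continuous_snd)).mem_nhds
        (show (x, w) ∈ {q : ℝ × ℂ | (17 / 20 : ℝ) < ‖q.2‖} by simp only [mem_setOf_eq]; linarith)]
        with q hq
      exact pol_eq_highPol hq.le
    exact hhigh.congr_of_eventuallyEq hev

/-! ### The polar map on `S² × ℝ²` -/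

section Sphere

/-- The **equatorial complex coordinate** `y = x₀ + i x₁` of a point of `S² ⊆ ℝ³` (rotations about
the polar axis multiply it by unit complex numbers). [folklore] -/
def ycoord (p : Metric.sphere (0 : EuclideanSpace ℝ (Fin 3)) 1) : ℂ :=
  ⟨(p : EuclideanSpace ℝ (Fin 3)) 0, (p : EuclideanSpace ℝ (Fin 3)) 1⟩

/-- `x = ‖y‖² = x₀² + x₁² = 1 - x₂²`, the squared distance from the polar axis. [folklore] -/
def xsq (p : Metric.sphere (0 : EuclideanSpace ℝ (Fin 3)) 1) : ℝ := ‖ycoord p‖ ^ 2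

/-- `x = x₀² + x₁²`. [folklore] -/
theorem xsq_eq (p : Metric.sphere (0 : EuclideanSpace ℝ (Fin 3)) 1) :
    xsq p = (p : EuclideanSpace ℝ (Fin 3)) 0 ^ 2 + (p : EuclideanSpace ℝ (Fin 3)) 1 ^ 2 := by
  rw [xsq, Complex.sq_norm, Complex.normSq_apply]
  simp [ycoord, sq]

/-- `0 ≤ x`. [folklore] -/
theorem xsq_nonneg (p : Metric.sphere (0 : EuclideanSpace ℝ (Fin 3)) 1) : 0 ≤ xsq p := sq_nonneg _

/-- A rotation about the polar axis multiplies the equatorial coordinate by the unit complex number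
`toC u`. [folklore] -/
theorem ycoord_rotateSphereTwo (u : Metric.sphere (0 : EuclideanSpace ℝ (Fin 2)) 1)
    (p : Metric.sphere (0 : EuclideanSpace ℝ (Fin 3)) 1) :
    ycoord (rotateSphereTwo u p) = toC (u : EuclideanSpace ℝ (Fin 2)) * ycoord p := by
  apply Complex.ext
  · simp [ycoord, toC]
  · simp [ycoord, toC]; ring

/-- Rotations about the polar axis preserve `x`. [folklore] -/
theorem xsq_rotateSphereTwo (u : Metric.sphere (0 : EuclideanSpace ℝ (Fin 2)) 1)
    (p : Metric.sphere (0 : EuclideanSpace ℝ (Fin 3)) 1) : xsq (rotateSphereTwo u p) = xsq p := by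
  rw [xsq, xsq, ycoord_rotateSphereTwo, norm_mul, norm_toC_sphere, one_mul]

/-- The linear map `ℝ³ → ℂ`, `v ↦ v₀ + i v₁`. [folklore] -/
def ycoordAux (v : EuclideanSpace ℝ (Fin 3)) : ℂ := ⟨v 0, v 1⟩

/-- `ycoordAux` is smooth (real linear). [folklore] -/
theorem contDiff_ycoordAux : ContDiff ℝ ∞ ycoordAux := by
  have : ycoordAux = fun v => equivRealProdCLM.symm (v 0, v 1) := by
    funext v; apply Complex.ext <;> simp [ycoordAux]
  rw [this]
  exact equivRealProdCLM.symm.contDiff.comp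
    ((contDiff_piLp_apply (p := 2) (i := (0 : Fin 3))).prodMk
      (contDiff_piLp_apply (p := 2) (i := (1 : Fin 3))))

/-- The equatorial coordinate is smooth on the sphere. [folklore] -/
theorem contMDiff_ycoord : ContMDiff (𝓡 2) 𝓘(ℝ, ℂ) ∞ ycoord :=
  haveI := Fact.mk (@finrank_euclideanSpace_fin ℝ _ 3)
  contDiff_ycoordAux.comp_contMDiff contMDiff_coe_sphere

/-- `x` is smooth on the sphere. [folklore] -/
theorem contMDiff_xsq : ContMDiff (𝓡 2) 𝓘(ℝ, ℝ) ∞ xsq :=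
  ((contDiff_norm_sq ℝ (E := ℂ)).comp_contMDiff contMDiff_ycoord)

/-- The isometry `ℂ → ℝ²`, `z ↦ (Re z, Im z)` (Mathlib's `Complex.orthonormalBasisOneI.repr`), the
inverse of the tree's `toC`. [folklore] -/
def toE (z : ℂ) : EuclideanSpace ℝ (Fin 2) := Complex.orthonormalBasisOneI.repr z

/-- `toC ∘ toE = id`. [folklore] -/
@[simp] theorem toC_toE (z : ℂ) : toC (toE z) = z := by
  rw [toC_eq_orthonormalBasisOneI_repr_symm, toE, LinearIsometryEquiv.symm_apply_apply]

/-- `toE ∘ toC = id`. [folklore] -/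
@[simp] theorem toE_toC (w : EuclideanSpace ℝ (Fin 2)) : toE (toC w) = w := by
  rw [toC_eq_orthonormalBasisOneI_repr_symm, toE, LinearIsometryEquiv.apply_symm_apply]

/-- `toE` preserves the norm. [folklore] -/
@[simp] theorem norm_toE (z : ℂ) : ‖toE z‖ = ‖z‖ := (Complex.orthonormalBasisOneI.repr).norm_map z

/-- `toE` is smooth (real linear). [folklore] -/
theorem contDiff_toE : ContDiff ℝ ∞ toE := (Complex.orthonormalBasisOneI.repr).toContinuousLinearEquiv.contDiff

/-- Coordinates of `toE`. [folklore] -/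
@[simp] theorem toE_apply_zero (z : ℂ) : toE z 0 = z.re := by
  simp [toE, Complex.orthonormalBasisOneI_repr_apply]

/-- Coordinates of `toE`. [folklore] -/
@[simp] theorem toE_apply_one (z : ℂ) : toE z 1 = z.im := by
  simp [toE, Complex.orthonormalBasisOneI_repr_apply]

/-- The point of the unit circle `𝕊¹ ⊆ ℝ²` in the direction of a complex number (junk `(1, 0)` at
`0`). [folklore] -/
def circleOf (z : ℂ) : Metric.sphere (0 : EuclideanSpace ℝ (Fin 2)) 1 := unitVector₀ (toE z)

/-- For a unit complex number the circle point is `(Re z, Im z)`. [folklore] -/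
theorem coe_circleOf {z : ℂ} (hz : ‖z‖ = 1) :
    (circleOf z : EuclideanSpace ℝ (Fin 2)) = toE z := by
  have h0 : toE z ≠ 0 := by rw [← norm_ne_zero_iff, norm_toE, hz]; exact one_ne_zero
  rw [circleOf, unitVector₀_of_ne_zero h0, coe_unitVector, norm_toE, hz, inv_one, one_smul]

/-- `toC` of the circle point of a unit complex number is the number. [folklore] -/
theorem toC_circleOf {z : ℂ} (hz : ‖z‖ = 1) :
    toC (circleOf z : EuclideanSpace ℝ (Fin 2)) = z := by
  rw [coe_circleOf hz, toC_toE]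

/-- The circle point of the inverse of a unit complex number is the conjugate point. [folklore] -/
theorem circleOf_inv {z : ℂ} (hz : ‖z‖ = 1) : circleOf z⁻¹ = conjCircle (circleOf z) := by
  have hz' : ‖z⁻¹‖ = 1 := by rw [norm_inv, hz, inv_one]
  apply Subtype.ext
  rw [coe_circleOf hz']
  ext i
  fin_cases i
  · simp [coe_circleOf hz, Complex.inv_re, Complex.normSq_eq_norm_sq, hz]
  · simp [coe_circleOf hz, Complex.inv_im, Complex.normSq_eq_norm_sq, hz]

/-- The circle point of the unit vector of `toC w` is the unit vector of `w`. [folklore] -/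
theorem circleOf_nrm_toC {w : EuclideanSpace ℝ (Fin 2)} (hw : w ≠ 0) :
    circleOf (nrm (toC w)) = unitVector₀ w := by
  have hpos : 0 < ‖w‖⁻¹ := inv_pos.2 (norm_pos_iff.2 hw)
  have h : toE (nrm (toC w)) = ‖w‖⁻¹ • w := by
    rw [nrm, norm_toC, toE, ← Complex.real_smul, map_smul]
    change ‖w‖⁻¹ • toE (toC w) = _
    rw [toE_toC]
  rw [circleOf, h, unitVector₀_of_ne_zero (smul_ne_zero hpos.ne' hw), unitVector₀_of_ne_zero hw,
    unitVector_smul hpos w hw]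

/-- The circle point map is smooth off the origin. [folklore] -/
theorem contMDiffAt_circleOf {z : ℂ} (hz : z ≠ 0) : ContMDiffAt 𝓘(ℝ, ℂ) (𝓡 1) ∞ circleOf z := by
  have h0 : toE z ≠ 0 := by rw [← norm_ne_zero_iff, norm_toE]; exact norm_ne_zero_iff.2 hz
  exact (contMDiffOn_unitVector₀.contMDiffAt (isOpen_ne.mem_nhds h0)).comp z
    contDiff_toE.contMDiff.contMDiffAt

/-- `toC w ≠ 0` for `w ≠ 0` (`toC` preserves the norm). [folklore] -/
theorem toC_ne_zero_of_ne_zero {w : EuclideanSpace ℝ (Fin 2)} (hw : w ≠ 0) : toC w ≠ 0 := by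
  rw [← norm_ne_zero_iff, norm_toC]; exact norm_ne_zero_iff.2 hw

/-- **The polar phase on the sphere**: `Pol(‖y(p)‖², w)` with `w` read as a complex number.
[folklore] -/
def polS (p : Metric.sphere (0 : EuclideanSpace ℝ (Fin 3)) 1) (w : EuclideanSpace ℝ (Fin 2)) : ℂ :=
  pol (xsq p) (toC w)

/-- The polar phase is invariant under rotations about the polar axis. [folklore] -/
theorem polS_rotateSphereTwo (u : Metric.sphere (0 : EuclideanSpace ℝ (Fin 2)) 1)
    (p : Metric.sphere (0 : EuclideanSpace ℝ (Fin 3)) 1) (w : EuclideanSpace ℝ (Fin 2)) :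
    polS (rotateSphereTwo u p) w = polS p w := by
  rw [polS, polS, xsq_rotateSphereTwo]

/-- **The polar map** `(p, w) ↦ (rot_{Pol(p, w)} p, w)` of `S² × ℝ²`: the model diffeomorphism of
Iwase's construction on the polar region (both caps at once), the inverse Gluck map where the
profile vanishes. [cite: Iwase1988, proof of Prop. 3.5 (p. 297)] -/
def polarMap (q : Metric.sphere (0 : EuclideanSpace ℝ (Fin 3)) 1 × EuclideanSpace ℝ (Fin 2)) :
    Metric.sphere (0 : EuclideanSpace ℝ (Fin 3)) 1 × EuclideanSpace ℝ (Fin 2) :=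
  (rotateSphereTwo (circleOf (polS q.1 q.2)) q.1, q.2)

/-- **The inverse polar map** `(p, w) ↦ (rot_{Pol(p, w)⁻¹} p, w)`. [folklore] -/
def polarMapInv (q : Metric.sphere (0 : EuclideanSpace ℝ (Fin 3)) 1 × EuclideanSpace ℝ (Fin 2)) :
    Metric.sphere (0 : EuclideanSpace ℝ (Fin 3)) 1 × EuclideanSpace ℝ (Fin 2) :=
  (rotateSphereTwo (circleOf (polS q.1 q.2)⁻¹) q.1, q.2)

/-- The polar maps preserve the second coordinate. [folklore] -/
@[simp] theorem polarMap_snd (q : Metric.sphere (0 : EuclideanSpace ℝ (Fin 3)) 1 ×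
    EuclideanSpace ℝ (Fin 2)) : (polarMap q).2 = q.2 := rfl

/-- The polar maps preserve the second coordinate. [folklore] -/
@[simp] theorem polarMapInv_snd (q : Metric.sphere (0 : EuclideanSpace ℝ (Fin 3)) 1 ×
    EuclideanSpace ℝ (Fin 2)) : (polarMapInv q).2 = q.2 := rfl

/-- The polar maps preserve `x`. [folklore] -/
theorem xsq_polarMap_fst (q : Metric.sphere (0 : EuclideanSpace ℝ (Fin 3)) 1 ×
    EuclideanSpace ℝ (Fin 2)) : xsq (polarMap q).1 = xsq q.1 := xsq_rotateSphereTwo _ _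

/-- **`polarMap ∘ polarMapInv = id` off the torus** (`‖w‖ < 1`, `w ≠ g(x)` as a complex number).
[folklore] -/
theorem polarMap_polarMapInv {q : Metric.sphere (0 : EuclideanSpace ℝ (Fin 3)) 1 ×
    EuclideanSpace ℝ (Fin 2)} (hw1 : ‖q.2‖ < 1) (hwg : toC q.2 ≠ gprof (xsq q.1)) :
    polarMap (polarMapInv q) = q := by
  obtain ⟨p, w⟩ := q
  have hunit : ‖polS p w‖ = 1 := norm_pol (by rwa [norm_toC]) hwg
  rw [polarMapInv, polarMap, Prod.mk.injEq]
  refine ⟨?_, rfl⟩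
  simp only
  rw [polS_rotateSphereTwo, circleOf_inv hunit, rotateSphereTwo_rotateSphereTwo_conjCircle]

/-- **`polarMapInv ∘ polarMap = id` off the torus.** [folklore] -/
theorem polarMapInv_polarMap {q : Metric.sphere (0 : EuclideanSpace ℝ (Fin 3)) 1 ×
    EuclideanSpace ℝ (Fin 2)} (hw1 : ‖q.2‖ < 1) (hwg : toC q.2 ≠ gprof (xsq q.1)) :
    polarMapInv (polarMap q) = q := by
  obtain ⟨p, w⟩ := q
  have hunit : ‖polS p w‖ = 1 := norm_pol (by rwa [norm_toC]) hwg
  rw [polarMap, polarMapInv, Prod.mk.injEq]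
  refine ⟨?_, rfl⟩
  simp only
  rw [polS_rotateSphereTwo, circleOf_inv hunit, rotateSphereTwo_conjCircle_rotateSphereTwo]

/-- **The polar map is the inverse Gluck map where the profile vanishes** (`x ≥ 1/5`: off the two
polar caps; `w ≠ 0`). [folklore] -/
theorem polarMap_eq_gluckMapInv_of_gprof {q : Metric.sphere (0 : EuclideanSpace ℝ (Fin 3)) 1 ×
    EuclideanSpace ℝ (Fin 2)} (hx : gprof (xsq q.1) = 0) (hw : q.2 ≠ 0) :
    polarMap q = gluckMapInv q := by
  obtain ⟨p, w⟩ := q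
  have hunit : ‖nrm (toC w)‖ = 1 := norm_nrm (toC_ne_zero_of_ne_zero hw)
  rw [polarMap, gluckMapInv_eq_of_ne_zero hw, Prod.mk.injEq]
  refine ⟨?_, rfl⟩
  simp only
  rw [polS, pol_eq_of_gprof_eq_zero hx, circleOf_inv hunit, circleOf_nrm_toC hw]

/-- **The polar map is the inverse Gluck map where the slice cut-off is complete** (heights
`≥ 17/20`). [folklore] -/
theorem polarMap_eq_gluckMapInv_of_muP {q : Metric.sphere (0 : EuclideanSpace ℝ (Fin 3)) 1 ×
    EuclideanSpace ℝ (Fin 2)} (hw : 17 / 20 ≤ ‖q.2‖) (hμ : muP (xsq q.1) (toC q.2) = 1) :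
    polarMap q = gluckMapInv q := by
  obtain ⟨p, w⟩ := q
  have hw0 : w ≠ 0 := fun h => by rw [h, norm_zero] at hw; norm_num at hw
  have hunit : ‖nrm (toC w)‖ = 1 := norm_nrm (toC_ne_zero_of_ne_zero hw0)
  rw [polarMap, gluckMapInv_eq_of_ne_zero hw0, Prod.mk.injEq]
  refine ⟨?_, rfl⟩
  simp only
  rw [polS, pol_eq_of_muP_eq_one (by rwa [norm_toC]) hμ, circleOf_inv hunit, circleOf_nrm_toC hw0]

/-- **The polar map is smooth off the torus** (`‖w‖ < 1`, `w ≠ g(‖y‖²)`), jointly in `(p, w)`: the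
phase is smooth (`contDiffAt_pol`), the circle point map is smooth off the origin, and the rotation
is jointly smooth (`contMDiff_rotateSphereTwo`). [folklore] -/
theorem contMDiffAt_polarMap {q : Metric.sphere (0 : EuclideanSpace ℝ (Fin 3)) 1 ×
    EuclideanSpace ℝ (Fin 2)} (hw1 : ‖q.2‖ < 1) (hwg : toC q.2 ≠ gprof (xsq q.1)) :
    ContMDiffAt ((𝓡 2).prod 𝓘(ℝ, EuclideanSpace ℝ (Fin 2))) ((𝓡 2).prod 𝓘(ℝ, EuclideanSpace ℝ (Fin 2)))
      ∞ polarMap q := by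
  have hw1' : ‖toC q.2‖ < 1 := by rwa [norm_toC]
  have hx : -(1 - ‖toC q.2‖) / 2 < xsq q.1 := by
    have := xsq_nonneg q.1; rw [norm_toC]; linarith
  -- the phase as a function on `S² × ℝ²`
  have hin : ContMDiffAt ((𝓡 2).prod 𝓘(ℝ, EuclideanSpace ℝ (Fin 2))) 𝓘(ℝ, ℝ × ℂ) ∞
      (fun q : Metric.sphere (0 : EuclideanSpace ℝ (Fin 3)) 1 × EuclideanSpace ℝ (Fin 2) =>
        (xsq q.1, toC q.2)) q :=
    (contMDiff_xsq.contMDiffAt.comp q contMDiffAt_fst).prodMk_space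
      (contDiff_toC.contMDiff.contMDiffAt.comp q contMDiffAt_snd)
  have hpol : ContMDiffAt ((𝓡 2).prod 𝓘(ℝ, EuclideanSpace ℝ (Fin 2))) 𝓘(ℝ, ℂ) ∞
      (fun q : Metric.sphere (0 : EuclideanSpace ℝ (Fin 3)) 1 × EuclideanSpace ℝ (Fin 2) =>
        polS q.1 q.2) q :=
    (contDiffAt_pol hw1' hx hwg).contMDiffAt.comp q hin
  have hcirc : ContMDiffAt ((𝓡 2).prod 𝓘(ℝ, EuclideanSpace ℝ (Fin 2))) (𝓡 1) ∞
      (circleOf ∘ fun q : Metric.sphere (0 : EuclideanSpace ℝ (Fin 3)) 1 × EuclideanSpace ℝ (Fin 2) =>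
        polS q.1 q.2) q :=
    (contMDiffAt_circleOf (pol_ne_zero hw1' hwg)).comp q hpol
  exact (contMDiff_rotateSphereTwo.contMDiffAt.comp q (hcirc.prodMk contMDiffAt_fst)).prodMk
    contMDiffAt_snd

end Sphere

end IwasePolar
end Literature.Topology.FourManifolds
end
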